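/-
COR-CM (cell pub-hodgecm2) — ¬hJ RUSH, ROW P-HEAD, HEAD FILE 2∕2 (pen nothj-p4 = prover-pub-hodgecm2-nothj-p4-g0-0), 2026-08-24.
The two-socket core (✔ `NotHJ.false_of_twoSockets`, `D2Bridge/OrientationT2NotHJTwoSocketCore.lean`) AT THE SOCKETS OF RECORD: a
component-Albanese record `J₁` for the TWISTED App.-C datum at instance `ι₁` (the hypothesis `hJ` of the hazard certificates P3–P8) is
CONTRADICTORY given ONLY Hodge-blind inputs — MULTIPLICITY ONE of the tower `H = colim_K H¹(X_K(ℂ); ℂ)` as a `ℂ[U(V)(𝔸_f)]`-module and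
ONE non-vanishing `(P-N) Ω(ν) = Hom_E(A_∞, A_ν)_ℚ ≠ 0` — via ✔ `MuKeyHazard.socket_conjAdm_of_componentAlbanese_iota1` (J₁ at ι₁, conjugate
key, (0,1)-classes) and ✔ `AdapterMuConjByValue.adapter_socket_sharedTail` (the tree's `componentAlbanesePinTotal` at ῑ₁, live key,
(1,0)-classes).  §6 the generic face over the App.-C datum of record at a CONJUGATE-typed character (`Φ_ν = Φ̄(typeOfLine (line i))` for a PhiMu
index line — the adapter's configuration).  THEOREMS ONLY; no `sorry`; no purity row, no block, no `hLiuC`, no conjugation `κ`.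
FRAMING: HC_CM is NOT proved; nothing here asserts hJ or ¬hJ; `J₁` is a HYPOTHESIS, NOT claimed to exist.
-/
import Summits.HodgeConjecture.CorCM.D2Bridge.OrientationT2NotHJTwoSocketCore
import HarnessLib

set_option autoImplicit false

noncomputable section

open scoped TensorProduct DirectSum

namespace Summit.HodgeConjecture.CorCM.D2Bridge.NotHJ

open NumberField
open HodgeCM HodgeCM.Model HodgeCM.Model.TowerCarrier HodgeCM.Model.TowerLevel
open HodgeCM.Literature.Theta HodgeCM.Literature.Theta.LiuAlbaneseModuleDatum
open HodgeCM.Literature.Theta.LiuAlbaneseModuleDatum.D2Bridge (HcmPieces hcm_of_pieces)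
open Literature.AlgebraicGeometry.Motives (CMType)
open Literature.AlgebraicGeometry.HodgeTheory Literature.NumberTheory.Automorphic.PicardCM
open Literature.AlgebraicGeometry.ShimuraVarieties.UnitaryCanonicalModel
open Literature.NumberTheory.Automorphic
open Literature.NumberTheory.Automorphic.Liu2021 Literature.NumberTheory.Automorphic.Liu2021.AppendixC
open Literature.NumberTheory.Automorphic.Liu2021.AppendixC.RestOne
open Literature.NumberTheory.Transcendental (Arapura2012_Cor_15_4_6)
open Literature.RepresentationTheory
open Summit.HodgeConjecture.CorCM.HComp

universe u v w

/-! ## §6 THE HEAD (generic face): multiplicity one + (P-N) + `J₁` at instance `ι₁` ⊢ `False` -/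

section Head

variable {L : HodgeCM.CMField} {ι₁ : (L : Type) →+* ℂ}

set_option synthInstance.maxHeartbeats 400000 in
set_option maxHeartbeats 6400000 in
/-- **P-HEAD (generic face).**  At a face `(L, ι₁, V, Φ)` with `L/ℚ` Galois and `4 ≤ [L:ℚ]`, the App.-C datum of record
`C := Model.sec42DataOf h iso (pkgF L) ι₁ (pkgV V) Φ` with its Hecke translates, a uniform carrier `U`, a split line `line i` with
`ι₁ ∈ typeOfLine (line i)` (`PhiMuLine`), a conjugate-typed weight-one conjugate-symplectic `ν` (`hsign : Φ_ν = Φ̄(typeOfLine (line i))`) with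
Def-4.5 carriers, ONE object `Dν ∈ 𝒜(ν)` and `τ' ∈ Φ_ν`.  DISPLAYED (Hodge-blind) inputs: (i) the tower `H = colim_K H¹(X_K(ℂ); ℂ)` is a
SEMISIMPLE `ℂ[U(V)(𝔸_f)]`-module whose ISOMORPHIC SIMPLE SUBMODULES COINCIDE (`hss ∕ hmf` — multiplicity one: the M2 interface, to be
discharged from the END-ELECT's [Prop 4.13]-shaped decomposition row + [Def 4.11] adjectives + [Lem D.1 (3)] separation), and (ii) `(P-N)`
`Ω(ν) = Hom_E(A_∞, A_ν)_ℚ ≠ 0` ([Thm 4.18] main clause with [Lem D.1 (1)]).  HYPOTHESIS: a component-Albanese record `J₁` for `C` under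
`algebraMap L ℂ = ι₁` with its level law.  Conclusion: `False` — by `false_of_twoSockets` at the two (c)(d) sockets of record
✔ `MuKeyHazard.socket_conjAdm_of_componentAlbanese_iota1` (J₁, conjugate key, (0,1)-classes) and ✔ `AdapterMuConjByValue.adapter_socket_sharedTail`
(the tree's `componentAlbanesePinTotal` at `ῑ₁`, live key, (1,0)-classes).  HC_CM is NOT proved; `J₁` is NOT claimed to exist.
[cite: Liu2021, Prop. 4.13 (FJcycle.tex l. 2113–2119), Def. 4.11, App. D Lem. D.1 (1),(3), Thm. 4.18 (l. 2232–2245) with proof map (4.2)∕(4.3) (l. 2247–2253), Rem. 4.4]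
[cite: VoisinHodgeI2002, §6.1.3 Cor. 6.14] [cite: Shimura1998, §8.3 Prop. 28] -/
theorem false_of_componentAlbanese_iota1_of_multOne_of_nontrivial
    {hHD : exists_isReal_hodgeModel} {hI : hodgePQ_independent_of_hodgeModel}
    {h₁ : BallQuotientUniformised} {h₃ : CMAbelianVarietyRealised} {hA : Arapura2012_Cor_15_4_6}
    [IsGalois ℚ (L : Type)] (hU7 : heckeTranslate_definedOver) (V : HodgeCM.HermSpace3 L ι₁) (h : exists_recordSystem)
    (h4 : 4 ≤ Module.finrank ℚ L) (Φ : CMType (pkgF L))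
    (iso : ∀ (F : Summit.HodgeConjecture.CorCM.CMField) (ι : F →+* ℂ) (_ : Summit.HodgeConjecture.CorCM.HermSpace3 F ι)
      (_ : CMType F), ℕ → Prop)
    (U : UniformOmega (Model.sec42DataOf h iso (pkgF L) ι₁ (pkgV V) Φ))
    {ν : Literature.NumberTheory.Automorphic.IdeleClassGroup L →ₜ* Circle} (hν : IdeleClassGroup.IsConjugateSymplectic (L : Type) ν)
    (hwν : IdeleClassGroup.HasWeight (L : Type) ν 1) (Carν : Def45.Carriers (L : Type) ν)
    (Dν : ObjOne (AlgHom.id ℚ (L : Type)) ι₁ hν hwν Carν) (τ' : L →+* ℂ) (hτ' : τ' ∈ hν.cmType.1)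
    (I : Type) (line : I → HodgeCM.Model.SplitLineE V) (i : I) (hi : HodgeCM.Model.SplitLine.PhiMuLine ι₁ (line i))
    (hsign : hν.cmType = HodgeCM.CMTypeOps.bar (HodgeCM.Model.SplitLine.typeOfLine (line i)))
    -- (i) multiplicity one of the tower `H` as a `ℂ[U(V)(𝔸_f)]`-module — DISPLAYED (M2 interface)
    (hss : IsSemisimpleModule (MonoidAlgebra ℂ ↥V.adelicFin) (Tower hHD hI (ballQuotientUniformisedDatum_of h₁) h₃ hA V))
    (hmf : ∀ S S' : Submodule (MonoidAlgebra ℂ ↥V.adelicFin) (Tower hHD hI (ballQuotientUniformisedDatum_of h₁) h₃ hA V),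
      IsAtom S → IsAtom S' → Nonempty (S ≃ₗ[MonoidAlgebra ℂ ↥V.adelicFin] S') → S = S')
    -- (ii) (P-N) non-vanishing of `Ω(ν) = Hom_E(A_∞, A_ν)_ℚ` — DISPLAYED
    (hPN : Nontrivial (toThm418Data _ (U.rest (restTailOne (AlgHom.id ℚ (L : Type)) ι₁ hν hwν Carν
      ((Model.sec42DataOf_heckeTranslates hU7 h (pkgV V) Φ iso h4).rhoΩOne (AlgHom.id ℚ (L : Type)) ι₁ hν hwν Carν)))).Ω)
    -- THE HYPOTHESIS: a component-Albanese record for `C` at instance `ι₁` (NOT in the tree), with its level law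
    [inst : Algebra (L : Type) ℂ] (hinst : ∀ x : (L : Type), algebraMap (L : Type) ℂ x = ι₁ x)
    (J₁ : ComponentAlbanese hHD hI (ballQuotientUniformisedDatum_of h₁) h₃ hA V h Φ
      (Model.sec42DataOf h iso (pkgF L) ι₁ (pkgV V) Φ) (Model.sec42DataOf_heckeTranslates hU7 h (pkgV V) Φ iso h4))
    (hΓ₁ : ∀ K₁ : C5.SmallLevel (Model.sec42DataOf h iso (pkgF L) ι₁ (pkgV V) Φ).S.K₀,
      ((J₁.Γof K₁).K : Subgroup ↥V.adelicFin) = (K₁.1 : Subgroup (Model.sec42DataOf h iso (pkgF L) ι₁ (pkgV V) Φ).G)) :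
    False := by
  -- the two sockets of record over the SAME datum
  obtain ⟨M, jH, hjHinj, hjH, hpieces⟩ :=
    MuKeyHazard.socket_conjAdm_of_componentAlbanese_iota1 (hHD := hHD) (hI := hI) (h₁ := h₁) (h₃ := h₃) (hA := hA)
      V h Φ (C := Model.sec42DataOf h iso (pkgF L) ι₁ (pkgV V) Φ) (HT := Model.sec42DataOf_heckeTranslates hU7 h (pkgV V) Φ iso h4)
      U hν hwν Carν Dν τ' hτ' I line i hsign hinst J₁ hΓ₁
  obtain ⟨Mb, jHb, hjHbinj, hjHb, hpiecesb⟩ :=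
    AdapterMuConjByValue.adapter_socket_sharedTail (hHD := hHD) (hI := hI) (h₁ := h₁) (h₃ := h₃) (hA := hA)
      hU7 V h h4 Φ iso U hν hwν Carν Dν τ' hτ' I line i hsign
  refine false_of_twoSockets (hHD := hHD) (hI := hI) (h₁ := h₁) (h₃ := h₃) (hA := hA) V h Φ
    (Model.sec42DataOf h iso (pkgF L) ι₁ (pkgV V) Φ) _ M Mb jH jHb hjHinj hjHbinj hjH hjHb
    (HodgeCM.Level.capThree (V := V) ((Model.sec42DataOf h iso (pkgF L) ι₁ (pkgV V) Φ).S.K₀.1 : Subgroup ↥V.adelicFin)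
      (Model.sec42DataOf h iso (pkgF L) ι₁ (pkgV V) Φ).S.K₀.2.1)
    (HodgeCM.Level.belowConjThree_capThree _ _) _ _ hpieces hpiecesb (fun K => ?_) (fun K => ?_) (fun f => ?_) hss hmf hPN
  · -- conjugate key: records admissible for `Φ_ν ∌ ι₁` through `ι₁` have their eigencharacter OUTSIDE their CM type ⇒ (0,1)-classes
    simpa using cmClasses_subset_hodge_piece_zero_one
      (LiuDictionary.ofTower hHD hI h₁ h₃ hA V I (fun i => {χ : (line i).CharW // (line i).IsAutChar χ})
        (fun i a => (line i).Ω (HodgeCM.Model.ιVE V) a.1) (fun i => HodgeCM.Model.SplitLine.PhiMuLine ι₁ (line i))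
        (fun i dd => dd.IsReflexOfTypeG ((starRingEnd ℂ).comp ι₁) (HodgeCM.Model.SplitLine.typeOfLine (line i)))) K i
      (fun d hd => tau_notMem_cmType_of_isReflexOfType_starRingEnd_comp ι₁ d _ (hd inferInstance) hi)
  · -- live key: (1,0)-classes
    simpa using cmClasses_subset_hodge_piece_one_zero_pin V I line K i hi
  · -- every `f ∈ Ω(ν)` comes from all deep levels, for both chosen objects
    obtain ⟨K, hK, hφ⟩ := exists_level_forall_res_eq V h Φ iso U hν hwν Carν _ M.Dμ f
    obtain ⟨K', hK', hφ'⟩ := exists_level_forall_res_eq V h Φ iso U hν hwν Carν _ Mb.Dμ f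
    exact ⟨K ⊓ K', inf_le_left.trans hK, fun Γ hle => ⟨hφ Γ (hle.trans inf_le_left), hφ' Γ (hle.trans inf_le_right)⟩⟩

end Head

end Summit.HodgeConjecture.CorCM.D2Bridge.NotHJ

end
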